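import Mathlib
import Summits.Ventures.PercRepro2.Defs
import Summits.Ventures.PercRepro2.Independence
import Summits.Ventures.PercRepro2.Harris
import Summits.Ventures.PercRepro2.Graph
import Summits.Ventures.PercRepro2.Exploration
import Summits.Ventures.PercRepro2.Events
import Summits.Ventures.PercRepro2.FourFunctions
import Summits.Ventures.PercRepro2.Induced
import Summits.Ventures.PercRepro2.Frontier
import Summits.Ventures.PercRepro2.ObsIndependence
import Summits.Ventures.PercRepro2.BHK
import Summits.Ventures.PercRepro2.BHKEvents
import Summits.Ventures.PercRepro2.OrderPreservation
import Summits.Ventures.PercRepro2.BHKAvoid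
import Summits.Ventures.PercRepro2.SameClusterAvoid
import Summits.Ventures.PercRepro2.CaseOneRegime
import Summits.Ventures.PercRepro2.CaseOnePos
import Summits.Ventures.PercRepro2.CaseOneJ11
import Summits.Ventures.PercRepro2.CaseOneRV
import Summits.Ventures.PercRepro2.CaseOnePendant
import Summits.Ventures.PercRepro2.CaseOnePendantAny
import Summits.Ventures.PercRepro2.CaseOnePendantNec
import Summits.Ventures.PercRepro2.CaseOneDWorld
import Summits.Ventures.PercRepro2.CaseOneDWorldPin
import Summits.Ventures.PercRepro2.HullDefs
import Summits.Ventures.PercRepro2.OneEdge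
import Summits.Ventures.PercRepro2.StarPattern
import Summits.Ventures.PercRepro2.HCov
import Summits.Ventures.PercRepro2.HCovSwap
import Summits.Ventures.PercRepro2.OddsLemma
import Summits.Ventures.PercRepro2.RV
import Summits.Ventures.PercRepro2.RVBridge
import Summits.Ventures.PercRepro2.CaseOneDWorldOdds
import Summits.Ventures.PercRepro2.CaseOneTwoMark
import Summits.Ventures.PercRepro2.CaseOneTwoMarkMass
import Summits.Ventures.PercRepro2.CaseOneTwoMarkD
import Summits.Ventures.PercRepro2.CaseOneTwoMarkBern

/-!
# `a₃` adjacent exactly to `o` and `b`: the Bernstein reduction of the Q-world `(ii)`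
(blind cell PercRepro2, p1 g14; S5 §2.1 (K9) (j)–(k), proofs/P1-DWORLD.md §4e)

The twelve base masses as a record `TMMasses`, the Q-world polynomial `iiQ r s m` (so that
`iiExpr = iiQ (p eo) (p eb) (tmMasses p₀₀ …)`, `iiExpr_eq_iiQ`), its `(3,3)`-Bernstein form
`iiQ_bern` (`9 · iiQ = Σ C(3,i) C(3,j) rⁱ(1−r)³⁻ⁱ sʲ(1−s)³⁻ʲ · tmBᵢⱼ m`, a ring identity), the
masses of the pinned law `tmMasses` with the relations `oU = o₁ + o₂`, `bU = b₁ + b`,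
`oUbU = ob + bo₁ + ob₁ + o₁b₁` under `Q₀`. The certified coefficients and the reduction of `(ii)` to
the five mixed ones are in `CaseOneTwoMarkRed.lean`. -/

namespace Summit.Ventures.PercRepro2

namespace CaseOne

/-- The twelve base masses of the two-mark class (`P₀ = p[eo ↦ 0][eb ↦ 0]`, `Q₀ = {a₁ ↮ a₂}`,
`Oᵢ = {aᵢ ↔ o}`, `Bᵢ = {aᵢ ↔ b}`, `U`-events `O₁ ∪ O₂`, `B₁ ∪ B₂`): `M = P₀(Q₀)`, `b = P₀(Q₀, B₂)`,
`ob = P₀(Q₀, O₂, B₂)`, `bo₁ = P₀(Q₀, O₁, B₂)`, `ob₁ = P₀(Q₀, B₁, O₂)`, `o₁ = P₀(Q₀, O₁)`,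
`b₁ = P₀(Q₀, B₁)`, `o₁b₁ = P₀(Q₀, O₁, B₁)`, `o₂ = P₀(Q₀, O₂)`, `oU = P₀(Q₀, o ∈ U)`,
`bU = P₀(Q₀, b ∈ U)`, `oUbU = P₀(Q₀, o ∈ U, b ∈ U)`. -/
structure TMMasses (R : Type*) where
  /-- `P₀(Q₀)` -/
  M : R
  /-- `P₀(Q₀, B₂)` -/
  b : R
  /-- `P₀(Q₀, O₂, B₂)` -/
  ob : R
  /-- `P₀(Q₀, O₁, B₂)` -/
  bo₁ : R
  /-- `P₀(Q₀, B₁, O₂)` -/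
  ob₁ : R
  /-- `P₀(Q₀, O₁)` -/
  o₁ : R
  /-- `P₀(Q₀, B₁)` -/
  b₁ : R
  /-- `P₀(Q₀, O₁, B₁)` -/
  o₁b₁ : R
  /-- `P₀(Q₀, O₂)` -/
  o₂ : R
  /-- `P₀(Q₀, o ∈ U)` -/
  oU : R
  /-- `P₀(Q₀, b ∈ U)` -/
  bU : R
  /-- `P₀(Q₀, o ∈ U, b ∈ U)` -/
  oUbU : R

section Poly
variable {R : Type*} [CommRing R]

/-- **The Q-world polynomial** of the two-mark class: `P(Q)·(−D_o·P(Q,A,B₂)) − P(Q,B₂)·(D·P(Q,A,O₂) −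
D_o·P(Q,A))` with the eight masses of `CaseOneTwoMarkMass/D` substituted (`r = p_o`, `s = p_b`). -/
def iiQ (r s : R) (m : TMMasses R) : R :=
  (m.M - r * s * (m.bo₁ + m.ob₁)) * (-((1 - r) * (m.oU - s * m.oUbU)) * (r * (1 - s) * m.bo₁)) -
    (m.b + r * s * (m.o₂ - m.ob - m.bo₁ - m.ob₁)) *
      ((m.M - r * m.oU - s * m.bU + r * s * m.oUbU) * ((1 - r) * s * m.ob₁) -
        (1 - r) * (m.oU - s * m.oUbU) *
          (r * (1 - s) * m.o₁ + (1 - r) * s * m.b₁ + r * s * (m.o₁ +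
            m.b₁ - m.o₁b₁ - m.bo₁ - m.ob₁)))

/-- `9 · B_{01}`: nine times the `(0,1)` Bernstein coefficient of the Q-world `(ii)`. -/
def tmB01 (m : TMMasses R) : R :=
  (-3 : R) * m.M * m.b * m.ob₁ + (3 : R) * m.b * m.b₁ * m.oU
/-- `9 · B_{02}`: nine times the `(0,2)` Bernstein coefficient of the Q-world `(ii)`. -/
def tmB02 (m : TMMasses R) : R :=
  (-6 : R) * m.M * m.b * m.ob₁ + (6 : R) * m.b * m.b₁ * m.oU + (-3 : R) * m.b * m.b₁ * m.oUbU +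
    (3 : R) * m.b * m.bU * m.ob₁
/-- `9 · B_{03}`: nine times the `(0,3)` Bernstein coefficient of the Q-world `(ii)`. -/
def tmB03 (m : TMMasses R) : R :=
  (-9 : R) * m.M * m.b * m.ob₁ + (9 : R) * m.b * m.b₁ * m.oU + (-9 : R) * m.b * m.b₁ * m.oUbU +
    (9 : R) * m.b * m.bU * m.ob₁
/-- `9 · B_{10}`: nine times the `(1,0)` Bernstein coefficient of the Q-world `(ii)`. -/
def tmB10 (m : TMMasses R) : R :=
  (-3 : R) * m.M * m.bo₁ * m.oU + (3 : R) * m.b * m.o₁ * m.oU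
/-- `9 · B_{11}`: nine times the `(1,1)` Bernstein coefficient of the Q-world `(ii)`. -/
def tmB11 (m : TMMasses R) : R :=
  (-2 : R) * m.M * m.b * m.ob₁ + (-2 : R) * m.M * m.bo₁ * m.oU + (1 : R) * m.M * m.bo₁ * m.oUbU +
    (2 : R) * m.b * m.b₁ * m.oU + (-1 : R) * m.b * m.bo₁ * m.oU + (3 : R) * m.b * m.o₁ * m.oU +
    (-1 : R) * m.b * m.o₁ * m.oUbU + (-1 : R) * m.b * m.o₁b₁ * m.oU
/-- `9 · B_{12}`: nine times the `(1,2)` Bernstein coefficient of the Q-world `(ii)`. -/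
def tmB12 (m : TMMasses R) : R :=
  (-4 : R) * m.M * m.b * m.ob₁ + (-1 : R) * m.M * m.bo₁ * m.oU + (1 : R) * m.M * m.bo₁ * m.oUbU +
    (1 : R) * m.M * m.bo₁ * m.ob₁ + (-1 : R) * m.M * m.o₂ * m.ob₁ + (1 : R) * m.M * m.ob * m.ob₁ +
    (1 : R) * m.M * m.ob₁ ^ 2 + (4 : R) * m.b * m.b₁ * m.oU + (-2 : R) * m.b * m.b₁ * m.oUbU +
    (2 : R) * m.b * m.bU * m.ob₁ + (-2 : R) * m.b * m.bo₁ * m.oU + (1 : R) * m.b * m.bo₁ * m.oUbU +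
    (3 : R) * m.b * m.o₁ * m.oU + (-2 : R) * m.b * m.o₁ * m.oUbU + (-2 : R) * m.b * m.o₁b₁ * m.oU +
    (1 : R) * m.b * m.o₁b₁ * m.oUbU + (-1 : R) * m.b₁ * m.bo₁ * m.oU +
    (1 : R) * m.b₁ * m.o₂ * m.oU + (-1 : R) * m.b₁ * m.oU * m.ob + (-1 : R) * m.b₁ * m.oU * m.ob₁
/-- `9 · B_{13}`: nine times the `(1,3)` Bernstein coefficient of the Q-world `(ii)`. -/
def tmB13 (m : TMMasses R) : R :=
  (-6 : R) * m.M * m.b * m.ob₁ + (3 : R) * m.M * m.bo₁ * m.ob₁ + (-3 : R) * m.M * m.o₂ * m.ob₁ +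
    (3 : R) * m.M * m.ob * m.ob₁ + (3 : R) * m.M * m.ob₁ ^ 2 + (6 : R) * m.b * m.b₁ * m.oU +
    (-6 : R) * m.b * m.b₁ * m.oUbU + (6 : R) * m.b * m.bU * m.ob₁ + (-3 : R) * m.b * m.bo₁ * m.oU +
    (3 : R) * m.b * m.bo₁ * m.oUbU + (3 : R) * m.b * m.o₁ * m.oU + (-3 : R) * m.b * m.o₁ * m.oUbU +
    (-3 : R) * m.b * m.o₁b₁ * m.oU + (3 : R) * m.b * m.o₁b₁ * m.oUbU +
    (-3 : R) * m.b₁ * m.bo₁ * m.oU + (3 : R) * m.b₁ * m.bo₁ * m.oUbU +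
    (3 : R) * m.b₁ * m.o₂ * m.oU + (-3 : R) * m.b₁ * m.o₂ * m.oUbU + (-3 : R) * m.b₁ * m.oU * m.ob +
    (-3 : R) * m.b₁ * m.oU * m.ob₁ + (3 : R) * m.b₁ * m.oUbU * m.ob +
    (3 : R) * m.b₁ * m.oUbU * m.ob₁ + (-3 : R) * m.bU * m.bo₁ * m.ob₁ +
    (3 : R) * m.bU * m.o₂ * m.ob₁ + (-3 : R) * m.bU * m.ob * m.ob₁ + (-3 : R) * m.bU * m.ob₁ ^ 2
/-- `9 · B_{20}`: nine times the `(2,0)` Bernstein coefficient of the Q-world `(ii)`. -/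
def tmB20 (m : TMMasses R) : R :=
  (-3 : R) * m.M * m.bo₁ * m.oU + (3 : R) * m.b * m.o₁ * m.oU
/-- `9 · B_{21}`: nine times the `(2,1)` Bernstein coefficient of the Q-world `(ii)`. -/
def tmB21 (m : TMMasses R) : R :=
  (-1 : R) * m.M * m.b * m.ob₁ + (-2 : R) * m.M * m.bo₁ * m.oU + (1 : R) * m.M * m.bo₁ * m.oUbU +
    (1 : R) * m.b * m.b₁ * m.oU + (-1 : R) * m.b * m.bo₁ * m.oU + (3 : R) * m.b * m.o₁ * m.oU +
    (-1 : R) * m.b * m.o₁ * m.oUbU + (-1 : R) * m.b * m.o₁b₁ * m.oU +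
    (-1 : R) * m.bo₁ * m.o₁ * m.oU + (1 : R) * m.bo₁ * m.oU * m.ob₁ + (1 : R) * m.bo₁ ^ 2 * m.oU +
    (1 : R) * m.o₁ * m.o₂ * m.oU + (-1 : R) * m.o₁ * m.oU * m.ob + (-1 : R) * m.o₁ * m.oU * m.ob₁
/-- `9 · B_{22}`: nine times the `(2,2)` Bernstein coefficient of the Q-world `(ii)`. -/
def tmB22 (m : TMMasses R) : R :=
  (-2 : R) * m.M * m.b * m.ob₁ + (-1 : R) * m.M * m.bo₁ * m.oU + (1 : R) * m.M * m.bo₁ * m.oUbU +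
    (1 : R) * m.M * m.bo₁ * m.ob₁ + (-1 : R) * m.M * m.o₂ * m.ob₁ + (1 : R) * m.M * m.ob * m.ob₁ +
    (1 : R) * m.M * m.ob₁ ^ 2 + (2 : R) * m.b * m.b₁ * m.oU + (-1 : R) * m.b * m.b₁ * m.oUbU +
    (1 : R) * m.b * m.bU * m.ob₁ + (-2 : R) * m.b * m.bo₁ * m.oU + (1 : R) * m.b * m.bo₁ * m.oUbU +
    (3 : R) * m.b * m.o₁ * m.oU + (-2 : R) * m.b * m.o₁ * m.oUbU + (-2 : R) * m.b * m.o₁b₁ * m.oU +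
    (1 : R) * m.b * m.o₁b₁ * m.oUbU + (-1 : R) * m.b₁ * m.bo₁ * m.oU +
    (1 : R) * m.b₁ * m.o₂ * m.oU + (-1 : R) * m.b₁ * m.oU * m.ob + (-1 : R) * m.b₁ * m.oU * m.ob₁ +
    (-2 : R) * m.bo₁ * m.o₁ * m.oU + (1 : R) * m.bo₁ * m.o₁ * m.oUbU +
    (1 : R) * m.bo₁ * m.o₁b₁ * m.oU + (-1 : R) * m.bo₁ * m.o₂ * m.oU +
    (1 : R) * m.bo₁ * m.oU * m.ob + (2 : R) * m.bo₁ * m.oU * m.ob₁ +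
    (-1 : R) * m.bo₁ * m.oUbU * m.ob₁ + (2 : R) * m.bo₁ ^ 2 * m.oU + (-1 : R) * m.bo₁ ^ 2 * m.oUbU +
    (2 : R) * m.o₁ * m.o₂ * m.oU + (-1 : R) * m.o₁ * m.o₂ * m.oUbU + (-2 : R) * m.o₁ * m.oU * m.ob +
    (-2 : R) * m.o₁ * m.oU * m.ob₁ + (1 : R) * m.o₁ * m.oUbU * m.ob +
    (1 : R) * m.o₁ * m.oUbU * m.ob₁ + (-1 : R) * m.o₁b₁ * m.o₂ * m.oU +
    (1 : R) * m.o₁b₁ * m.oU * m.ob + (1 : R) * m.o₁b₁ * m.oU * m.ob₁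
/-- `9 · B_{23}`: nine times the `(2,3)` Bernstein coefficient of the Q-world `(ii)`. -/
def tmB23 (m : TMMasses R) : R :=
  (-3 : R) * m.M * m.b * m.ob₁ + (3 : R) * m.M * m.bo₁ * m.ob₁ + (-3 : R) * m.M * m.o₂ * m.ob₁ +
    (3 : R) * m.M * m.ob * m.ob₁ + (3 : R) * m.M * m.ob₁ ^ 2 + (3 : R) * m.b * m.b₁ * m.oU +
    (-3 : R) * m.b * m.b₁ * m.oUbU + (3 : R) * m.b * m.bU * m.ob₁ + (-3 : R) * m.b * m.bo₁ * m.oU +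
    (3 : R) * m.b * m.bo₁ * m.oUbU + (3 : R) * m.b * m.o₁ * m.oU + (-3 : R) * m.b * m.o₁ * m.oUbU +
    (-3 : R) * m.b * m.o₁b₁ * m.oU + (3 : R) * m.b * m.o₁b₁ * m.oUbU +
    (-3 : R) * m.b₁ * m.bo₁ * m.oU + (3 : R) * m.b₁ * m.bo₁ * m.oUbU +
    (3 : R) * m.b₁ * m.o₂ * m.oU + (-3 : R) * m.b₁ * m.o₂ * m.oUbU + (-3 : R) * m.b₁ * m.oU * m.ob +
    (-3 : R) * m.b₁ * m.oU * m.ob₁ + (3 : R) * m.b₁ * m.oUbU * m.ob +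
    (3 : R) * m.b₁ * m.oUbU * m.ob₁ + (-3 : R) * m.bU * m.bo₁ * m.ob₁ +
    (3 : R) * m.bU * m.o₂ * m.ob₁ + (-3 : R) * m.bU * m.ob * m.ob₁ + (-3 : R) * m.bU * m.ob₁ ^ 2 +
    (-3 : R) * m.bo₁ * m.o₁ * m.oU + (3 : R) * m.bo₁ * m.o₁ * m.oUbU +
    (3 : R) * m.bo₁ * m.o₁b₁ * m.oU + (-3 : R) * m.bo₁ * m.o₁b₁ * m.oUbU +
    (-3 : R) * m.bo₁ * m.o₂ * m.oU + (3 : R) * m.bo₁ * m.o₂ * m.oUbU +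
    (3 : R) * m.bo₁ * m.oU * m.ob + (3 : R) * m.bo₁ * m.oU * m.ob₁ +
    (-3 : R) * m.bo₁ * m.oUbU * m.ob + (-3 : R) * m.bo₁ * m.oUbU * m.ob₁ +
    (3 : R) * m.bo₁ ^ 2 * m.oU + (-3 : R) * m.bo₁ ^ 2 * m.oUbU + (3 : R) * m.o₁ * m.o₂ * m.oU +
    (-3 : R) * m.o₁ * m.o₂ * m.oUbU + (-3 : R) * m.o₁ * m.oU * m.ob +
    (-3 : R) * m.o₁ * m.oU * m.ob₁ + (3 : R) * m.o₁ * m.oUbU * m.ob +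
    (3 : R) * m.o₁ * m.oUbU * m.ob₁ + (-3 : R) * m.o₁b₁ * m.o₂ * m.oU +
    (3 : R) * m.o₁b₁ * m.o₂ * m.oUbU + (3 : R) * m.o₁b₁ * m.oU * m.ob +
    (3 : R) * m.o₁b₁ * m.oU * m.ob₁ + (-3 : R) * m.o₁b₁ * m.oUbU * m.ob +
    (-3 : R) * m.o₁b₁ * m.oUbU * m.ob₁

set_option maxRecDepth 100000 in
/-- **The `(3,3)`-Bernstein form of `9 · iiQ`** (obq_bern.py; `B₀₀ = B₃ⱼ = 0`). -/
theorem iiQ_bern (r s : R) (m : TMMasses R) :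
    9 * iiQ r s m =
      (3 : R) * r ^ 0 * (1 - r) ^ 3 * s ^ 1 * (1 - s) ^ 2 * tmB01 m +
      (3 : R) * r ^ 0 * (1 - r) ^ 3 * s ^ 2 * (1 - s) ^ 1 * tmB02 m +
      (1 : R) * r ^ 0 * (1 - r) ^ 3 * s ^ 3 * (1 - s) ^ 0 * tmB03 m +
      (3 : R) * r ^ 1 * (1 - r) ^ 2 * s ^ 0 * (1 - s) ^ 3 * tmB10 m +
      (9 : R) * r ^ 1 * (1 - r) ^ 2 * s ^ 1 * (1 - s) ^ 2 * tmB11 m +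
      (9 : R) * r ^ 1 * (1 - r) ^ 2 * s ^ 2 * (1 - s) ^ 1 * tmB12 m +
      (3 : R) * r ^ 1 * (1 - r) ^ 2 * s ^ 3 * (1 - s) ^ 0 * tmB13 m +
      (3 : R) * r ^ 2 * (1 - r) ^ 1 * s ^ 0 * (1 - s) ^ 3 * tmB20 m +
      (9 : R) * r ^ 2 * (1 - r) ^ 1 * s ^ 1 * (1 - s) ^ 2 * tmB21 m +
      (9 : R) * r ^ 2 * (1 - r) ^ 1 * s ^ 2 * (1 - s) ^ 1 * tmB22 m +
      (3 : R) * r ^ 2 * (1 - r) ^ 1 * s ^ 3 * (1 - s) ^ 0 * tmB23 m := by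
  unfold iiQ tmB01 tmB02 tmB03 tmB10 tmB11 tmB12 tmB13 tmB20 tmB21 tmB22 tmB23
  ring

end Poly

/-! ## The masses of the pinned law, the relations under `Q₀`, and the certified coefficients -/

section Masses
variable {V : Type*} {E : Type*} [Fintype E] [DecidableEq E] {R : Type*} [CommRing R]

/-- The twelve base masses for the weights `p` (used with `p = p[eo ↦ 0][eb ↦ 0]`). -/
noncomputable def tmMasses (p : E → R) (ends : E → Sym2 V) (o a₁ a₂ b : V) : TMMasses R where
  M := prob p (connEvent ends a₁ a₂)ᶜ
  b := prob p ((connEvent ends a₁ a₂)ᶜ ∩ connEvent ends a₂ b)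
  ob := prob p ((connEvent ends a₁ a₂)ᶜ ∩ connEvent ends a₂ o ∩ connEvent ends a₂ b)
  bo₁ := prob p ((connEvent ends a₁ a₂)ᶜ ∩ connEvent ends a₁ o ∩ connEvent ends a₂ b)
  ob₁ := prob p ((connEvent ends a₁ a₂)ᶜ ∩ connEvent ends a₁ b ∩ connEvent ends a₂ o)
  o₁ := prob p ((connEvent ends a₁ a₂)ᶜ ∩ connEvent ends a₁ o)
  b₁ := prob p ((connEvent ends a₁ a₂)ᶜ ∩ connEvent ends a₁ b)
  o₁b₁ := prob p ((connEvent ends a₁ a₂)ᶜ ∩ connEvent ends a₁ o ∩ connEvent ends a₁ b)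
  o₂ := prob p ((connEvent ends a₁ a₂)ᶜ ∩ connEvent ends a₂ o)
  oU := prob p ((connEvent ends a₁ a₂)ᶜ ∩ (connEvent ends a₁ o ∪ connEvent ends a₂ o))
  bU := prob p ((connEvent ends a₁ a₂)ᶜ ∩ (connEvent ends a₁ b ∪ connEvent ends a₂ b))
  oUbU := prob p ((connEvent ends a₁ a₂)ᶜ ∩ (connEvent ends a₁ o ∪ connEvent ends a₂ o) ∩
    (connEvent ends a₁ b ∪ connEvent ends a₂ b))

variable {ends : E → Sym2 V} {o b a₃ : V} {eo eb : E}

/-- **`iiExpr` is the Q-world polynomial at the pinned masses** for `a₃ ~ {o, b}`. -/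
theorem iiExpr_eq_iiQ (p : E → R) (h : IsTwoMarkAt ends o b a₃ eo eb) {a₁ a₂ : V} (h1 : a₁ ≠ a₃)
    (h2 : a₂ ≠ a₃) :
    iiExpr p ends o a₁ a₂ a₃ b =
      iiQ (p eo) (p eb) (tmMasses (Function.update (Function.update p eo 0) eb 0) ends o a₁ a₂ b) := by
  rw [iiExpr_twoMark p h h1 h2, Dpd_twoMark p h h1 h2, Dpdo_twoMark p h h1 h2]
  unfold iiQ tmMasses
  ring

omit [Fintype E] [DecidableEq E] [CommRing R] in
/-- Under `Q₀`, `O₁` and `O₂` are disjoint (`a₁ ↔ o ↔ a₂` would join the roots). -/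
lemma disjoint_o1_o2 (a₁ a₂ : V) :
    Disjoint ((connEvent ends a₁ a₂)ᶜ ∩ connEvent ends a₁ o)
      ((connEvent ends a₁ a₂)ᶜ ∩ connEvent ends a₂ o) :=
  Set.disjoint_left.2 fun _ hω hω' => hω.1 (conn_trans hω.2 (conn_symm hω'.2))

/-- `oU = o₁ + o₂`. -/
theorem tmMasses_oU (p : E → R) (a₁ a₂ : V) :
    (tmMasses p ends o a₁ a₂ b).oU = (tmMasses p ends o a₁ a₂ b).o₁ + (tmMasses p ends o a₁ a₂ b).o₂ := by
  show prob p _ = prob p _ + prob p _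
  rw [Set.inter_union_distrib_left]
  exact prob_union_of_disjoint p (disjoint_o1_o2 a₁ a₂)

/-- `bU = b₁ + b`. -/
theorem tmMasses_bU (p : E → R) (a₁ a₂ : V) :
    (tmMasses p ends o a₁ a₂ b).bU = (tmMasses p ends o a₁ a₂ b).b₁ + (tmMasses p ends o a₁ a₂ b).b := by
  show prob p _ = prob p _ + prob p _
  rw [Set.inter_union_distrib_left]
  exact prob_union_of_disjoint p (disjoint_o1_o2 (o := b) a₁ a₂)

/-- `oUbU = ob + bo₁ + ob₁ + o₁b₁` (the four cells). -/
theorem tmMasses_oUbU (p : E → R) (a₁ a₂ : V) :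
    (tmMasses p ends o a₁ a₂ b).oUbU = (tmMasses p ends o a₁ a₂ b).ob + (tmMasses p ends o a₁ a₂ b).bo₁ +
      (tmMasses p ends o a₁ a₂ b).ob₁ + (tmMasses p ends o a₁ a₂ b).o₁b₁ := by
  show prob p _ = prob p _ + prob p _ + prob p _ + prob p _
  have e : (connEvent ends a₁ a₂)ᶜ ∩ (connEvent ends a₁ o ∪ connEvent ends a₂ o) ∩
      (connEvent ends a₁ b ∪ connEvent ends a₂ b) =
      (((connEvent ends a₁ a₂)ᶜ ∩ connEvent ends a₂ o ∩ connEvent ends a₂ b) ∪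
        ((connEvent ends a₁ a₂)ᶜ ∩ connEvent ends a₁ o ∩ connEvent ends a₂ b)) ∪
      (((connEvent ends a₁ a₂)ᶜ ∩ connEvent ends a₁ b ∩ connEvent ends a₂ o) ∪
        ((connEvent ends a₁ a₂)ᶜ ∩ connEvent ends a₁ o ∩ connEvent ends a₁ b)) := by
    ext ω
    simp only [Set.mem_inter_iff, Set.mem_union, Set.mem_compl_iff]
    tauto
  rw [e]
  have d1 : Disjoint ((connEvent ends a₁ a₂)ᶜ ∩ connEvent ends a₂ o ∩ connEvent ends a₂ b)
      ((connEvent ends a₁ a₂)ᶜ ∩ connEvent ends a₁ o ∩ connEvent ends a₂ b) :=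
    Set.disjoint_left.2 fun _ hω hω' => hω.1.1 (conn_trans hω'.1.2 (conn_symm hω.1.2))
  have d2 : Disjoint ((connEvent ends a₁ a₂)ᶜ ∩ connEvent ends a₁ b ∩ connEvent ends a₂ o)
      ((connEvent ends a₁ a₂)ᶜ ∩ connEvent ends a₁ o ∩ connEvent ends a₁ b) :=
    Set.disjoint_left.2 fun _ hω hω' => hω.1.1 (conn_trans hω'.1.2 (conn_symm hω.2))
  have d3 : Disjoint (((connEvent ends a₁ a₂)ᶜ ∩ connEvent ends a₂ o ∩ connEvent ends a₂ b) ∪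
      ((connEvent ends a₁ a₂)ᶜ ∩ connEvent ends a₁ o ∩ connEvent ends a₂ b))
      (((connEvent ends a₁ a₂)ᶜ ∩ connEvent ends a₁ b ∩ connEvent ends a₂ o) ∪
      ((connEvent ends a₁ a₂)ᶜ ∩ connEvent ends a₁ o ∩ connEvent ends a₁ b)) := by
    refine Set.disjoint_left.2 fun _ hω hω' => ?_
    rcases hω with hω | hω <;> rcases hω' with hω' | hω'
    · exact hω.1.1 (conn_trans hω'.1.2 (conn_symm hω.2))
    · exact hω.1.1 (conn_trans hω'.2 (conn_symm hω.2))
    · exact hω.1.1 (conn_trans hω.1.2 (conn_symm hω'.2))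
    · exact hω.1.1 (conn_trans hω'.2 (conn_symm hω.2))
  rw [prob_union_of_disjoint p d3, prob_union_of_disjoint p d1, prob_union_of_disjoint p d2]
  ring

end Masses

end CaseOne

end Summit.Ventures.PercRepro2
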